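import Summits.QuantumFields.BalabanUV.Beta.GAN24.WilsonVertexSumZero

/-!
# `BalabanUV.Beta.GAN24.WilsonVertexTwoLegSums` — W3-L3 (Z-E), PART 1: ALL THREE TWO-LEG ROW SUMS OF THE COLOURLESS WILSON CUBIC
# TABLE VANISH IDENTICALLY IN THE THIRD LEG — `Σ_{u,w} wilsonA d κ′ u w y a b = 0` (fixed `y`) and `Σ_{u,y} wilsonA d κ′ u w y a b = 0` (fixed `w`)

NOT IN PRINT; OUR PROOF ATTEMPT (row G-an2-4 ∕ (CONV-C), W-slot located remainder «T2Shape», road «W3» of the row owner's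
`SKELETON-W3.md` v0.1 §2 W3-L3 (Z-E), RULINGS-12 (R12-7) idle-seat invitation «W3-ZE*», CLAIMS.log l.7330; this seat's INTENT l.7448).
HONEST FRAMING (cell contract, verbatim): «discharging `BetaPertH` makes Bałaban's UV stability UNCONDITIONAL — a real constructive-QFT
result; it is NOT the continuum limit and NOT the Clay problem.»  HONEST DEPENDENCY (verbatim): «continuum YM on T⁴ ⇐ BetaPertH ∧ nine
spine estimates (0/9 proved); BetaPertH ⇐ (D1) ∧ (D4) ∧ CAP+tail; G-an2-4 gates asym, D1 and NE2/3/4.»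

WHAT.  leaf-15's W1 (`GAN24/WilsonVertexSumZero.wilsonA_sum_zero_of_supp`) is the pair (kernel leg, kernel leg): at a FIXED table leg
`(κ′, u)` the double sum over the two kernel-leg sites `(w, y)` of an4's antisymmetrised colourless Wilson cubic table `StepJetData.wilsonA`
vanishes.  The exchange ∕ second-response SOURCES of the W-slot's flattened recursion (SKELETON-W3 §1.2, classes (E-ff), (R)) see the
cubic table with its TABLE leg `(κ′, u)` and ONE kernel leg contracted against constants (the zero-momentum sector, after the coset
reproduction of the response columns) and the OTHER kernel leg free (into `Γ̃_m` ∕ `K2OfK`).  This file supplies the two MIXED pairs: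
for every fixed kernel-leg site the double sum over the bond `u` and the other kernel-leg site vanishes, for every block `a b : Fib d`
(§3: `wilsonA_sum_zero_bond_left/right`, support-free `wilsonA_tsum_zero_bond_left/right`).  Mechanism = W1's: by leaf-15's
`wEntry_eq_sum` an entry is an indicator sum over an3's stencil index `i`, and when ANY two of the three sites are summed each index
contributes exactly once, so every such double sum equals `Σ_i wc κ′ i α β = 0` (leaf-15's `sum_wc_eq_zero`, = leaf-18-g10's colour-block
cancellation).  §1 the raw table `wEntry` (bond + row summed at fixed column; bond + column summed at fixed row); §2 the support in the
BOND variable (the bonds whose stencil touches a given site: `{y − wα i} ∪ {y − wβ i}`, written inline — no `def`); §3 the antisymmetrised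
table, finite and `tsum` forms.  [folklore] finite algebra; generic `d`; 0 def, no cited fact, no `def … : Prop`, 0 sorry.  PART 2 (the pushed ∕ channel instantiation on the composite legs of
`e3Of m` and the (E-ff)∕(R) sources) waits on the owner's census v0.2 and diagnostics D-W-3 (R-W3-1∕R-W3-3).  Asserts NO shape of
Bałaban's tables; discharges NOTHING of «T2Shape» ∕ (hW, hWall); NOT «W-slot closed», NEVER «G-an2-4 closed»; NOT `BetaPertH`, NOT
continuum, NOT Clay.  Unit `b2b-balaban-gan24-formalise-leaf-10` (gen 16), 2026-08-20.
-/

noncomputable section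

open Finset
open scoped BigOperators
open Literature.MathematicalPhysics.QuantumFieldTheory.Balaban1983to89
open Literature.MathematicalPhysics.QuantumFieldTheory.Balaban1983to89.Beta
open PlaquetteStencilData (WilsonIdx wα wβ isOffset_wα isOffset_wβ)
open StepJetData (wEntry wilsonA)
open BalabanStepJets (box1 mem_box1)
open OneStepResolventKernel (Fib)
open Summit.QuantumFields.BalabanUV.Beta.GAN24.WilsonVertexSumZero (uv wc wEntry_eq_sum sum_wc_eq_zero suppW row_mem_suppW
  col_mem_suppW wilsonA_eq_zero_left wilsonA_eq_zero_right mem_box1_of_isOffset)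

namespace Summit.QuantumFields.BalabanUV.Beta.GAN24.WilsonVertexTwoLegSums

variable {d : ℕ}

/-! ## §1 The raw table: bond + one site summed, the other site fixed -/

/-- [folklore] an entry vanishes unless its BOND is `x −` a row offset of the stencil (row site `x` fixed). -/
theorem wEntry_eq_zero_of_bond_row (κ' : Fin (d + 1)) (u x z : Fin (d + 1) → ℤ) (α β : Fin (d + 1))
    (h : ∀ i, u ≠ x - wα uv κ' i) : wEntry d κ' u x z α β = 0 := by
  rw [wEntry_eq_sum]
  exact Finset.sum_eq_zero fun i _ => if_neg fun hc => h i (by rw [hc.1]; abel)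

/-- [folklore] an entry vanishes unless its BOND is `z −` a column offset of the stencil (column site `z` fixed). -/
theorem wEntry_eq_zero_of_bond_col (κ' : Fin (d + 1)) (u x z : Fin (d + 1) → ℤ) (α β : Fin (d + 1))
    (h : ∀ i, u ≠ z - wβ uv κ' i) : wEntry d κ' u x z α β = 0 := by
  rw [wEntry_eq_sum]
  exact Finset.sum_eq_zero fun i _ => if_neg fun hc => h i (by rw [hc.2]; abel)

/-- [folklore] **BOND + ROW SITE SUMMED, COLUMN SITE FIXED**: for finite sets `Su ∋ z − wβ i` and `Sx ∋ z − wβ i + wα i` (all `i`),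
`Σ_{u∈Su} Σ_{x∈Sx} wEntry d κ′ u x z α β = Σ_i wc κ′ i α β = 0` — each stencil index contributes exactly once. -/
theorem wEntry_sum_bond_row_zero (κ' : Fin (d + 1)) (z : Fin (d + 1) → ℤ) (α β : Fin (d + 1)) (Su Sx : Finset (Fin (d + 1) → ℤ))
    (hu : ∀ i, z - wβ uv κ' i ∈ Su) (hx : ∀ i, z - wβ uv κ' i + wα uv κ' i ∈ Sx) :
    ∑ u ∈ Su, ∑ x ∈ Sx, wEntry d κ' u x z α β = 0 := by
  have h1 : ∀ u x, wEntry d κ' u x z α β = ∑ i, if x = u + wα uv κ' i ∧ z = u + wβ uv κ' i then wc κ' i α β else 0 :=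
    fun u x => wEntry_eq_sum κ' u x z α β
  simp_rw [h1]
  have h2 : ∀ u ∈ Su, ∑ x ∈ Sx, ∑ i, (if x = u + wα uv κ' i ∧ z = u + wβ uv κ' i then wc κ' i α β else 0) =
      ∑ i, ∑ x ∈ Sx, (if x = u + wα uv κ' i ∧ z = u + wβ uv κ' i then wc κ' i α β else 0) := fun u _ => Finset.sum_comm
  rw [Finset.sum_congr rfl h2, Finset.sum_comm]
  refine (Finset.sum_congr rfl fun i _ => ?_).trans (sum_wc_eq_zero κ' α β)
  rw [Finset.sum_eq_single_of_mem (z - wβ uv κ' i) (hu i)]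
  · rw [Finset.sum_eq_single_of_mem (z - wβ uv κ' i + wα uv κ' i) (hx i)]
    · rw [if_pos ⟨rfl, by abel⟩]
    · intro x _ hxne
      split_ifs with h
      · exact absurd h.1 hxne
      · rfl
  · intro u _ hune
    refine Finset.sum_eq_zero fun x _ => ?_
    split_ifs with h
    · exact absurd (by rw [h.2]; abel) hune
    · rfl

/-- [folklore] **BOND + COLUMN SITE SUMMED, ROW SITE FIXED**: for finite sets `Su ∋ x − wα i` and `Sz ∋ x − wα i + wβ i` (all `i`),
`Σ_{u∈Su} Σ_{z∈Sz} wEntry d κ′ u x z α β = Σ_i wc κ′ i α β = 0`. -/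
theorem wEntry_sum_bond_col_zero (κ' : Fin (d + 1)) (x : Fin (d + 1) → ℤ) (α β : Fin (d + 1)) (Su Sz : Finset (Fin (d + 1) → ℤ))
    (hu : ∀ i, x - wα uv κ' i ∈ Su) (hz : ∀ i, x - wα uv κ' i + wβ uv κ' i ∈ Sz) :
    ∑ u ∈ Su, ∑ z ∈ Sz, wEntry d κ' u x z α β = 0 := by
  have h1 : ∀ u z, wEntry d κ' u x z α β = ∑ i, if x = u + wα uv κ' i ∧ z = u + wβ uv κ' i then wc κ' i α β else 0 :=
    fun u z => wEntry_eq_sum κ' u x z α β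
  simp_rw [h1]
  have h2 : ∀ u ∈ Su, ∑ z ∈ Sz, ∑ i, (if x = u + wα uv κ' i ∧ z = u + wβ uv κ' i then wc κ' i α β else 0) =
      ∑ i, ∑ z ∈ Sz, (if x = u + wα uv κ' i ∧ z = u + wβ uv κ' i then wc κ' i α β else 0) := fun u _ => Finset.sum_comm
  rw [Finset.sum_congr rfl h2, Finset.sum_comm]
  refine (Finset.sum_congr rfl fun i _ => ?_).trans (sum_wc_eq_zero κ' α β)
  rw [Finset.sum_eq_single_of_mem (x - wα uv κ' i) (hu i)]
  · rw [Finset.sum_eq_single_of_mem (x - wα uv κ' i + wβ uv κ' i) (hz i)]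
    · rw [if_pos ⟨by abel, rfl⟩]
    · intro z _ hzne
      split_ifs with h
      · exact absurd h.2 hzne
      · rfl
  · intro u _ hune
    refine Finset.sum_eq_zero fun z _ => ?_
    split_ifs with h
    · exact absurd (by rw [h.1]; abel) hune
    · rfl

/-! ## §2 Support in the bond variable (no `def`: the bond support of a site `y` is `{y − wα i} ∪ {y − wβ i}`, used inline) -/

/-- [folklore] off the bond support of the SECOND kernel-leg site the table vanishes (every block, every first site). -/
theorem wilsonA_eq_zero_of_bond_right (κ' : Fin (d + 1)) {u : Fin (d + 1) → ℤ} (w : Fin (d + 1) → ℤ) {y : Fin (d + 1) → ℤ}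
    (hα : ∀ i, u ≠ y - wα uv κ' i) (hβ : ∀ i, u ≠ y - wβ uv κ' i) (a b : Fib d) : wilsonA d κ' u w y a b = 0 := by
  rcases a with α | μ <;> rcases b with β | ν
  · show 1 / 2 * (wEntry d κ' u w y α β - wEntry d κ' u y w β α) = 0
    rw [wEntry_eq_zero_of_bond_col κ' u w y α β hβ, wEntry_eq_zero_of_bond_row κ' u y w β α hα]
    ring
  all_goals rfl

/-- [folklore] off the bond support of the FIRST kernel-leg site the table vanishes (every block, every second site). -/
theorem wilsonA_eq_zero_of_bond_left (κ' : Fin (d + 1)) {u : Fin (d + 1) → ℤ} {w : Fin (d + 1) → ℤ}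
    (hα : ∀ i, u ≠ w - wα uv κ' i) (hβ : ∀ i, u ≠ w - wβ uv κ' i) (y : Fin (d + 1) → ℤ) (a b : Fib d) :
    wilsonA d κ' u w y a b = 0 := by
  rcases a with α | μ <;> rcases b with β | ν
  · show 1 / 2 * (wEntry d κ' u w y α β - wEntry d κ' u y w β α) = 0
    rw [wEntry_eq_zero_of_bond_row κ' u w y α β hα, wEntry_eq_zero_of_bond_col κ' u y w β α hβ]
    ring
  all_goals rfl

/-- [folklore] the bond support of a site lies in the translated box `y − {−1,0,1}^{d+1}`: off it the table vanishes (decay bookkeeping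
form for the pushed versions). -/
theorem wilsonA_eq_zero_of_bond_right_box (κ' : Fin (d + 1)) {u : Fin (d + 1) → ℤ} (w : Fin (d + 1) → ℤ) {y : Fin (d + 1) → ℤ}
    (hu : u ∉ (box1 (d + 1)).image fun v => y - v) (a b : Fib d) : wilsonA d κ' u w y a b = 0 :=
  wilsonA_eq_zero_of_bond_right κ' w
    (fun i h => hu (by rw [h]; exact Finset.mem_image_of_mem _ (mem_box1_of_isOffset (isOffset_wα uv κ' i))))
    (fun i h => hu (by rw [h]; exact Finset.mem_image_of_mem _ (mem_box1_of_isOffset (isOffset_wβ uv κ' i)))) a b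

/-- [folklore] the same for the first kernel-leg site. -/
theorem wilsonA_eq_zero_of_bond_left_box (κ' : Fin (d + 1)) {u : Fin (d + 1) → ℤ} {w : Fin (d + 1) → ℤ}
    (hu : u ∉ (box1 (d + 1)).image fun v => w - v) (y : Fin (d + 1) → ℤ) (a b : Fib d) : wilsonA d κ' u w y a b = 0 :=
  wilsonA_eq_zero_of_bond_left κ'
    (fun i h => hu (by rw [h]; exact Finset.mem_image_of_mem _ (mem_box1_of_isOffset (isOffset_wα uv κ' i))))
    (fun i h => hu (by rw [h]; exact Finset.mem_image_of_mem _ (mem_box1_of_isOffset (isOffset_wβ uv κ' i)))) y a b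

/-- [folklore] off leaf-15's site support `suppW κ′ u` (first site) the table vanishes — W1's `wilsonA_eq_zero_left` for every block. -/
theorem wilsonA_eq_zero_left' (κ' : Fin (d + 1)) (u : Fin (d + 1) → ℤ) {w : Fin (d + 1) → ℤ} (hw : w ∉ suppW κ' u)
    (y : Fin (d + 1) → ℤ) (a b : Fib d) : wilsonA d κ' u w y a b = 0 := by
  rcases a with α | μ <;> rcases b with β | ν
  · exact wilsonA_eq_zero_left κ' u hw y α β
  all_goals rfl

/-- [folklore] off leaf-15's site support `suppW κ′ u` (second site) the table vanishes — W1's `wilsonA_eq_zero_right` for every block. -/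
theorem wilsonA_eq_zero_right' (κ' : Fin (d + 1)) (u w : Fin (d + 1) → ℤ) {y : Fin (d + 1) → ℤ} (hy : y ∉ suppW κ' u)
    (a b : Fib d) : wilsonA d κ' u w y a b = 0 := by
  rcases a with α | μ <;> rcases b with β | ν
  · exact wilsonA_eq_zero_right κ' u w hy α β
  all_goals rfl

/-! ## §3 The antisymmetrised table: bond + one kernel leg summed, the other kernel leg fixed -/

/-- [folklore] **(Z-E)₀, LEFT FORM — BOND AND FIRST KERNEL LEG SUMMED, SECOND KERNEL LEG FIXED**: for finite sets
`Su ⊇ {y − wα i} ∪ {y − wβ i}` and `Sw ⊇ suppW κ′ u` for every `u ∈ Su`, and every block `a b`,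
`Σ_{u∈Su} Σ_{w∈Sw} wilsonA d κ′ u w y a b = 0`.  (The cubic Wilson current on two constant legs — the table leg and one kernel
leg — vanishes IDENTICALLY in the third leg.) -/
theorem wilsonA_sum_zero_bond_left (κ' : Fin (d + 1)) (y : Fin (d + 1) → ℤ) (a b : Fib d) (Su Sw : Finset (Fin (d + 1) → ℤ))
    (hα : ∀ i, y - wα uv κ' i ∈ Su) (hβ : ∀ i, y - wβ uv κ' i ∈ Su) (hSw : ∀ u ∈ Su, suppW κ' u ⊆ Sw) :
    ∑ u ∈ Su, ∑ w ∈ Sw, wilsonA d κ' u w y a b = 0 := by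
  rcases a with α | μ <;> rcases b with β | ν
  · have h1 : ∀ u w, wilsonA d κ' u w y (Sum.inl α) (Sum.inl β) =
        1 / 2 * wEntry d κ' u w y α β - 1 / 2 * wEntry d κ' u y w β α :=
      fun u w => by show 1 / 2 * (wEntry d κ' u w y α β - wEntry d κ' u y w β α) = _; ring
    simp_rw [h1, Finset.sum_sub_distrib, ← Finset.mul_sum]
    rw [wEntry_sum_bond_row_zero κ' y α β Su Sw hβ (fun i => hSw _ (hβ i) (row_mem_suppW κ' _ i)),
      wEntry_sum_bond_col_zero κ' y β α Su Sw hα (fun i => hSw _ (hα i) (col_mem_suppW κ' _ i))]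
    ring
  all_goals exact Finset.sum_eq_zero fun _ _ => Finset.sum_eq_zero fun _ _ => rfl

/-- [folklore] **(Z-E)₀, RIGHT FORM — BOND AND SECOND KERNEL LEG SUMMED, FIRST KERNEL LEG FIXED**: for finite sets
`Su ⊇ {w − wα i} ∪ {w − wβ i}` and `Sy ⊇ suppW κ′ u` for every `u ∈ Su`, and every block `a b`,
`Σ_{u∈Su} Σ_{y∈Sy} wilsonA d κ′ u w y a b = 0`. -/
theorem wilsonA_sum_zero_bond_right (κ' : Fin (d + 1)) (w : Fin (d + 1) → ℤ) (a b : Fib d) (Su Sy : Finset (Fin (d + 1) → ℤ))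
    (hα : ∀ i, w - wα uv κ' i ∈ Su) (hβ : ∀ i, w - wβ uv κ' i ∈ Su) (hSy : ∀ u ∈ Su, suppW κ' u ⊆ Sy) :
    ∑ u ∈ Su, ∑ y ∈ Sy, wilsonA d κ' u w y a b = 0 := by
  rcases a with α | μ <;> rcases b with β | ν
  · have h1 : ∀ u y, wilsonA d κ' u w y (Sum.inl α) (Sum.inl β) =
        1 / 2 * wEntry d κ' u w y α β - 1 / 2 * wEntry d κ' u y w β α :=
      fun u y => by show 1 / 2 * (wEntry d κ' u w y α β - wEntry d κ' u y w β α) = _; ring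
    simp_rw [h1, Finset.sum_sub_distrib, ← Finset.mul_sum]
    rw [wEntry_sum_bond_col_zero κ' w α β Su Sy hα (fun i => hSy _ (hα i) (col_mem_suppW κ' _ i)),
      wEntry_sum_bond_row_zero κ' w β α Su Sy hβ (fun i => hSy _ (hβ i) (row_mem_suppW κ' _ i))]
    ring
  all_goals exact Finset.sum_eq_zero fun _ _ => Finset.sum_eq_zero fun _ _ => rfl

/-- [folklore] **(Z-E)₀, LEFT, SUPPORT-FREE FORM**: `∑' u, ∑' w, wilsonA d κ′ u w y a b = 0` for every fixed second site `y` and block. -/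
theorem wilsonA_tsum_zero_bond_left (κ' : Fin (d + 1)) (y : Fin (d + 1) → ℤ) (a b : Fib d) :
    ∑' u, ∑' w, wilsonA d κ' u w y a b = 0 := by
  set Su : Finset (Fin (d + 1) → ℤ) :=
    (Finset.univ.image fun i => y - wα uv κ' i) ∪ Finset.univ.image fun i => y - wβ uv κ' i with hSu_def
  have hα : ∀ i, y - wα uv κ' i ∈ Su := fun i => Finset.mem_union_left _ (Finset.mem_image_of_mem _ (Finset.mem_univ i))
  have hβ : ∀ i, y - wβ uv κ' i ∈ Su := fun i => Finset.mem_union_right _ (Finset.mem_image_of_mem _ (Finset.mem_univ i))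
  have hoff : ∀ u ∉ Su, ∀ w, wilsonA d κ' u w y a b = 0 := by
    intro u hu w
    exact wilsonA_eq_zero_of_bond_right κ' w (fun i h => hu (by rw [h]; exact hα i)) (fun i h => hu (by rw [h]; exact hβ i)) a b
  set Sw : Finset (Fin (d + 1) → ℤ) := Su.biUnion fun u => suppW κ' u with hSw_def
  have hSw : ∀ u ∈ Su, suppW κ' u ⊆ Sw := fun u hu => Finset.subset_biUnion_of_mem (fun u => suppW κ' u) hu
  have hin : ∀ u, ∑' w, wilsonA d κ' u w y a b = ∑ w ∈ suppW κ' u, wilsonA d κ' u w y a b :=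
    fun u => tsum_eq_sum fun w hw => wilsonA_eq_zero_left' κ' u hw y a b
  simp_rw [hin]
  rw [tsum_eq_sum (s := Su) fun u hu => Finset.sum_eq_zero fun w _ => hoff u hu w]
  have hwid : ∀ u ∈ Su, ∑ w ∈ suppW κ' u, wilsonA d κ' u w y a b = ∑ w ∈ Sw, wilsonA d κ' u w y a b :=
    fun u hu => Finset.sum_subset (hSw u hu) fun w _ hw => wilsonA_eq_zero_left' κ' u hw y a b
  rw [Finset.sum_congr rfl hwid]
  exact wilsonA_sum_zero_bond_left κ' y a b Su Sw hα hβ hSw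

/-- [folklore] **(Z-E)₀, RIGHT, SUPPORT-FREE FORM**: `∑' u, ∑' y, wilsonA d κ′ u w y a b = 0` for every fixed first site `w` and block. -/
theorem wilsonA_tsum_zero_bond_right (κ' : Fin (d + 1)) (w : Fin (d + 1) → ℤ) (a b : Fib d) :
    ∑' u, ∑' y, wilsonA d κ' u w y a b = 0 := by
  set Su : Finset (Fin (d + 1) → ℤ) :=
    (Finset.univ.image fun i => w - wα uv κ' i) ∪ Finset.univ.image fun i => w - wβ uv κ' i with hSu_def
  have hα : ∀ i, w - wα uv κ' i ∈ Su := fun i => Finset.mem_union_left _ (Finset.mem_image_of_mem _ (Finset.mem_univ i))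
  have hβ : ∀ i, w - wβ uv κ' i ∈ Su := fun i => Finset.mem_union_right _ (Finset.mem_image_of_mem _ (Finset.mem_univ i))
  have hoff : ∀ u ∉ Su, ∀ y, wilsonA d κ' u w y a b = 0 := by
    intro u hu y
    exact wilsonA_eq_zero_of_bond_left κ' (fun i h => hu (by rw [h]; exact hα i)) (fun i h => hu (by rw [h]; exact hβ i)) y a b
  set Sy : Finset (Fin (d + 1) → ℤ) := Su.biUnion fun u => suppW κ' u with hSy_def
  have hSy : ∀ u ∈ Su, suppW κ' u ⊆ Sy := fun u hu => Finset.subset_biUnion_of_mem (fun u => suppW κ' u) hu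
  have hin : ∀ u, ∑' y, wilsonA d κ' u w y a b = ∑ y ∈ suppW κ' u, wilsonA d κ' u w y a b :=
    fun u => tsum_eq_sum fun y hy => wilsonA_eq_zero_right' κ' u w hy a b
  simp_rw [hin]
  rw [tsum_eq_sum (s := Su) fun u hu => Finset.sum_eq_zero fun y _ => hoff u hu y]
  have hwid : ∀ u ∈ Su, ∑ y ∈ suppW κ' u, wilsonA d κ' u w y a b = ∑ y ∈ Sy, wilsonA d κ' u w y a b :=
    fun u hu => Finset.sum_subset (hSy u hu) fun y _ hy => wilsonA_eq_zero_right' κ' u w hy a b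
  rw [Finset.sum_congr rfl hwid]
  exact wilsonA_sum_zero_bond_right κ' w a b Su Sy hα hβ hSy

/-- [folklore] **ALL THREE TWO-LEG ZERO MODES OF THE CUBIC TABLE, AT ONCE** (W1 = leaf-15's `wilsonA_tsum_zero`, extended to every
block; the two mixed pairs = this file): for every bond direction `κ′` and block `a b`,
`(∀ u, ∑' w, ∑' y, wilsonA … = 0) ∧ (∀ y, ∑' u, ∑' w, wilsonA … = 0) ∧ (∀ w, ∑' u, ∑' y, wilsonA … = 0)`. -/
theorem wilsonA_twoLeg_tsum_zero (κ' : Fin (d + 1)) (a b : Fib d) :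
    (∀ u : Fin (d + 1) → ℤ, ∑' w, ∑' y, wilsonA d κ' u w y a b = 0) ∧
      (∀ y : Fin (d + 1) → ℤ, ∑' u, ∑' w, wilsonA d κ' u w y a b = 0) ∧
        (∀ w : Fin (d + 1) → ℤ, ∑' u, ∑' y, wilsonA d κ' u w y a b = 0) := by
  refine ⟨fun u => ?_, fun y => wilsonA_tsum_zero_bond_left κ' y a b, fun w => wilsonA_tsum_zero_bond_right κ' w a b⟩
  rcases a with α | μ <;> rcases b with β | ν
  · exact WilsonVertexSumZero.wilsonA_tsum_zero κ' u α β
  · have h : ∀ w y : Fin (d + 1) → ℤ, wilsonA d κ' u w y (Sum.inl α) (Sum.inr ν) = 0 := fun _ _ => rfl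
    simp only [h, tsum_zero]
  · have h : ∀ w y : Fin (d + 1) → ℤ, wilsonA d κ' u w y (Sum.inr μ) (Sum.inl β) = 0 := fun _ _ => rfl
    simp only [h, tsum_zero]
  · have h : ∀ w y : Fin (d + 1) → ℤ, wilsonA d κ' u w y (Sum.inr μ) (Sum.inr ν) = 0 := fun _ _ => rfl
    simp only [h, tsum_zero]

end Summit.QuantumFields.BalabanUV.Beta.GAN24.WilsonVertexTwoLegSums

end
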